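import Summits.NavierStokesRegularity.NavierStokesRegularity.Theorems.EulerZoomLiouvillePowerGaugeEulerLiouvilleBackwardPoincare
import Literature.Analysis.FluidPDE.WeakGradientSlicing
import Literature.Analysis.FluidPDE.TaoEnstrophyLocalisationProofs
import HarnessLib

/-!
# Tools for the backward vanishing of the power-gauged ancient Euler class (route `EulerZoomLiouville`,
# crux `PowerGaugeEulerLiouville` = stmt-NavierStokesRegularity-19832, line `birth`, STUB 2
# `stub_backwardVanishing`)

Helper file (theorems only) for the proof of `stub_backwardVanishing` (companion file
`…BackwardVanishing.lean`): the measure-theoretic and arithmetic pieces.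

* `mul_volume_sep_le_setLIntegral_prod` — (E1) Markov in time on a cylinder:
  `λ · |{τ ∈ S : λ ≤ ∫_B F(τ, ·)}| ≤ ∫∫_{S×B} F` for a.e.-measurable `F ≥ 0`;
* `enorm_rpow_two_le_ofReal_frobeniusNormSq`, `eLpNorm_two_le_of_frobenius`, `eLpNorm_two_eq_sqrt`,
  `lintegral_enorm_sq_le_of_eLpNorm_le` — `L²` bookkeeping (`‖·‖ ≤ |·|_F`, squaring `eLpNorm` bounds);
* `lintegral_ball_le_of_gaugeA` — the `A`-gauge on a slice: `a^{2ρ} A(u; Q_a(0)) ≤ c` gives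
  `∫_{B_a} |u(s)|² ≤ c a^{1-2ρ}` for `s ∈ (-a², 0)` (adapted from rung A, `…LargeRho.lean`);
* `volume_ball_pow_four_rpow_half` (`|B(x₀, 4ᵏR)|^{1/2} = 8ᵏ|B(x₀, R)|^{1/2}`),
  `two_pow_mul_inv_eight_pow`, `chebyshev_ratio_le` — the dyadic and exponent arithmetic.

WHAT THIS IS NOT: not NS / Euler — pure measure theory and real arithmetic. [folklore]
-/


noncomputable section

-- the summit and its single problem share the name `NavierStokesRegularity` (D-0017 nested layout)
set_option linter.dupNamespace false

open MeasureTheory Set Filter Topology Metric Module TopologicalSpace Function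
open scoped NNReal ENNReal

namespace Summit.NavierStokesRegularity.NavierStokesRegularity.Theorems.PowerGaugeEulerLiouville.Backward

open Literature.Analysis Literature.Analysis.FunctionSpaces Literature.Analysis.FluidPDE

/-! ## Tools -/

/-- **Markov in time on a cylinder (E1).**  For an a.e.-measurable `F ≥ 0` on `S × B`:
`λ · |{τ ∈ S : λ ≤ ∫_B F(τ, ·)}| ≤ ∫∫_{S × B} F`. [folklore] -/
theorem mul_volume_sep_le_setLIntegral_prod {F : ℝ × EuclideanSpace ℝ (Fin 3) → ℝ≥0∞} {S : Set ℝ}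
    {B : Set (EuclideanSpace ℝ (Fin 3))} (hF : AEMeasurable F (volume.restrict (S ×ˢ B)))
    (lam : ℝ≥0∞) :
    lam * volume {τ ∈ S | lam ≤ ∫⁻ y in B, F (τ, y)} ≤ ∫⁻ q in S ×ˢ B, F q := by
  have hprod : (volume.restrict (S ×ˢ B) : Measure (ℝ × EuclideanSpace ℝ (Fin 3))) =
      (volume.restrict S).prod (volume.restrict B) := by
    rw [Measure.volume_eq_prod, Measure.prod_restrict]
  rw [hprod] at hF ⊢
  rw [lintegral_prod _ hF]
  have hem : AEMeasurable (fun τ => ∫⁻ y in B, F (τ, y)) (volume.restrict S) :=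
    hF.lintegral_prod_right'
  have hM := mul_meas_ge_le_lintegral₀ hem lam
  refine le_trans (mul_le_mul' le_rfl ?_) hM
  calc volume {τ ∈ S | lam ≤ ∫⁻ y in B, F (τ, y)}
      = volume ({τ | lam ≤ ∫⁻ y in B, F (τ, y)} ∩ S) := by
        congr 1; ext τ; simp only [mem_setOf_eq, mem_inter_iff]; tauto
    _ ≤ volume.restrict S {τ | lam ≤ ∫⁻ y in B, F (τ, y)} := Measure.le_restrict_apply _ _

/-- `‖L‖ₑ² ≤ |L|²_F` (operator norm versus Frobenius norm), `ℝ≥0∞` form. [folklore] -/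
theorem enorm_rpow_two_le_ofReal_frobeniusNormSq
    (L : EuclideanSpace ℝ (Fin 3) →L[ℝ] EuclideanSpace ℝ (Fin 3)) :
    ‖L‖ₑ ^ (2 : ℝ) ≤ ENNReal.ofReal (frobeniusNormSq L) := by
  rw [← ofReal_norm, ENNReal.ofReal_rpow_of_nonneg (norm_nonneg _) (by norm_num),
    Real.rpow_two]
  exact ENNReal.ofReal_le_ofReal (sq_opNorm_le_frobeniusNormSq L)

/-- `eLpNorm g 2 ≤ (∫ |g|²_F)^{1/2}` for a field of linear maps on a set. [folklore] -/
theorem eLpNorm_two_le_of_frobenius {S : Set (EuclideanSpace ℝ (Fin 3))}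
    (g : EuclideanSpace ℝ (Fin 3) → EuclideanSpace ℝ (Fin 3) →L[ℝ] EuclideanSpace ℝ (Fin 3)) :
    eLpNorm g 2 (volume.restrict S) ≤
      (∫⁻ y in S, ENNReal.ofReal (frobeniusNormSq (g y))) ^ (1 / 2 : ℝ) := by
  rw [eLpNorm_eq_lintegral_rpow_enorm_toReal two_ne_zero ENNReal.ofNat_ne_top, ENNReal.toReal_ofNat]
  gcongr with y
  exact enorm_rpow_two_le_ofReal_frobeniusNormSq (g y)

/-- `eLpNorm f 2 = (∫ ‖f‖ₑ²)^{1/2}` (natural-number exponent inside). [folklore] -/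
theorem eLpNorm_two_eq_sqrt {α : Type*} [MeasurableSpace α] {μ : Measure α}
    (f : α → EuclideanSpace ℝ (Fin 3)) :
    eLpNorm f 2 μ = (∫⁻ y, ‖f y‖ₑ ^ 2 ∂μ) ^ (1 / 2 : ℝ) := by
  rw [eLpNorm_eq_lintegral_rpow_enorm_toReal two_ne_zero ENNReal.ofNat_ne_top, ENNReal.toReal_ofNat]
  congr 1
  refine lintegral_congr fun y => ?_
  rw [← ENNReal.rpow_natCast]
  norm_num

/-- Squaring `eLpNorm f 2 ≤ b`: `∫ ‖f‖ₑ² ≤ b²`. [folklore] -/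
theorem lintegral_enorm_sq_le_of_eLpNorm_le {α : Type*} [MeasurableSpace α] {μ : Measure α}
    {f : α → EuclideanSpace ℝ (Fin 3)} {b : ℝ≥0∞} (h : eLpNorm f 2 μ ≤ b) :
    ∫⁻ y, ‖f y‖ₑ ^ 2 ∂μ ≤ b ^ 2 := by
  rw [eLpNorm_two_eq_sqrt] at h
  have h2 := ENNReal.rpow_le_rpow h (by norm_num : (0 : ℝ) ≤ 2)
  rw [← ENNReal.rpow_mul] at h2
  norm_num at h2
  rw [← ENNReal.rpow_natCast]
  norm_num
  exact h2

/-- **The `A`-gauge on a slice**: if `a^{2ρ} A(u; Q_a(0)) ≤ c` then for every `s ∈ (-a², 0)`,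
`∫_{B(0,a)} |u(s)|² ≤ c · a^{1-2ρ}` (adapted from `…PowerGaugeEulerLiouvilleLargeRho.lean`, rung A of the
birth package). [folklore] -/
theorem lintegral_ball_le_of_gaugeA {u : ℝ → EuclideanSpace ℝ (Fin 3) → EuclideanSpace ℝ (Fin 3)}
    {ρ : ℝ} {c : ℝ≥0} {a : ℝ} (ha : 0 < a)
    (hA : ENNReal.ofReal (a ^ (2 * ρ)) * cknA a (0 : ℝ × EuclideanSpace ℝ (Fin 3)) u ≤ (c : ℝ≥0∞))
    {s : ℝ} (hs : s ∈ Ioo (-(a ^ 2)) 0) :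
    ∫⁻ x in ball (0 : EuclideanSpace ℝ (Fin 3)) a, ‖u s x‖ₑ ^ 2 ≤ ENNReal.ofReal ((c : ℝ) * a ^ (1 - 2 * ρ)) := by
  -- adapted from Theorems/EulerZoomLiouvillePowerGaugeEulerLiouvilleLargeRho.lean (Step 1)
  have hslice : (ENNReal.ofReal a)⁻¹ * ∫⁻ x in ball (0 : EuclideanSpace ℝ (Fin 3)) a, ‖u s x‖ₑ ^ 2 ≤
      cknA a (0 : ℝ × EuclideanSpace ℝ (Fin 3)) u := by
    unfold cknA
    have hs' : s ∈ Ioo ((0 : ℝ × EuclideanSpace ℝ (Fin 3)).1 - a ^ 2) (0 : ℝ × EuclideanSpace ℝ (Fin 3)).1 := by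
      simpa using hs
    exact le_iSup₂ (f := fun t (_ : t ∈ Ioo ((0 : ℝ × EuclideanSpace ℝ (Fin 3)).1 - a ^ 2)
        (0 : ℝ × EuclideanSpace ℝ (Fin 3)).1) =>
        (ENNReal.ofReal a)⁻¹ * ∫⁻ x in ball (0 : ℝ × EuclideanSpace ℝ (Fin 3)).2 a, ‖u t x‖ₑ ^ 2) s hs'
  have hB0 : ENNReal.ofReal (a ^ (2 * ρ)) ≠ 0 := by
    rw [ENNReal.ofReal_ne_zero_iff]; exact Real.rpow_pos_of_pos ha _
  have hA0 : ENNReal.ofReal a ≠ 0 := by rw [ENNReal.ofReal_ne_zero_iff]; exact ha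
  have h2 : ENNReal.ofReal (a ^ (2 * ρ)) *
      ((ENNReal.ofReal a)⁻¹ * ∫⁻ x in ball (0 : EuclideanSpace ℝ (Fin 3)) a, ‖u s x‖ₑ ^ 2) ≤ (c : ℝ≥0∞) :=
    le_trans (mul_le_mul' le_rfl hslice) hA
  have h3 : ∫⁻ x in ball (0 : EuclideanSpace ℝ (Fin 3)) a, ‖u s x‖ₑ ^ 2 ≤
      ENNReal.ofReal a * (ENNReal.ofReal (a ^ (2 * ρ)))⁻¹ * (c : ℝ≥0∞) := by
    have key : ∫⁻ x in ball (0 : EuclideanSpace ℝ (Fin 3)) a, ‖u s x‖ₑ ^ 2 =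
        ENNReal.ofReal a * (ENNReal.ofReal (a ^ (2 * ρ)))⁻¹ *
          (ENNReal.ofReal (a ^ (2 * ρ)) *
            ((ENNReal.ofReal a)⁻¹ * ∫⁻ x in ball (0 : EuclideanSpace ℝ (Fin 3)) a, ‖u s x‖ₑ ^ 2)) := by
      rw [← mul_assoc, mul_assoc (ENNReal.ofReal a), ENNReal.inv_mul_cancel hB0 ENNReal.ofReal_ne_top,
        mul_one, ← mul_assoc, ENNReal.mul_inv_cancel hA0 ENNReal.ofReal_ne_top, one_mul]
    rw [key]
    exact mul_le_mul' le_rfl h2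
  refine le_trans h3 (le_of_eq ?_)
  rw [← ENNReal.ofReal_inv_of_pos (Real.rpow_pos_of_pos ha _), ← ENNReal.ofReal_mul ha.le,
    ← ENNReal.ofReal_coe_nnreal, ← ENNReal.ofReal_mul (by positivity)]
  congr 1
  rw [← Real.rpow_neg ha.le, mul_comm, show (1 - 2 * ρ) = (-(2 * ρ)) + 1 by ring,
    Real.rpow_add ha, Real.rpow_one]
  ring

/-- `|B(x₀, 4ᵏ R)|^{1/2} = 8ᵏ |B(x₀, R)|^{1/2}`. [folklore] -/
theorem volume_ball_pow_four_rpow_half (x₀ : EuclideanSpace ℝ (Fin 3)) {R : ℝ} (hR : 0 < R) (k : ℕ) :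
    volume (ball x₀ (4 ^ k * R)) ^ (1 / 2 : ℝ) = 8 ^ k * volume (ball x₀ R) ^ (1 / 2 : ℝ) := by
  have h1 : volume (ball x₀ (4 ^ k * R)) = ((8 : ℝ≥0∞) ^ k) ^ 2 * volume (ball x₀ R) := by
    rw [volume_ball_eq x₀ (by positivity), volume_ball_eq x₀ hR, ← mul_assoc, ← pow_four_cube_eq]
    congr 1
    rw [ENNReal.ofReal_mul (by positivity), mul_pow, ENNReal.ofReal_pow (by norm_num) k]
    norm_num
  rw [h1, ENNReal.mul_rpow_of_nonneg _ _ (by norm_num)]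
  congr 1
  rw [← ENNReal.rpow_natCast, ← ENNReal.rpow_mul]
  norm_num

/-- `2ᵏ · (8ᵏ)⁻¹ = (4ᵏ)⁻¹` in `ℝ≥0∞`. [folklore] -/
theorem two_pow_mul_inv_eight_pow (k : ℕ) : (2 : ℝ≥0∞) ^ k * ((8 : ℝ≥0∞) ^ k)⁻¹ = ((4 : ℝ≥0∞) ^ k)⁻¹ := by
  have h8 : (8 : ℝ≥0∞) ^ k = 2 ^ k * 4 ^ k := by rw [← mul_pow]; norm_num
  rw [h8, ENNReal.mul_inv (Or.inl (pow_ne_zero _ two_ne_zero))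
    (Or.inl (ENNReal.pow_ne_top ENNReal.ofNat_ne_top)), ← mul_assoc,
    ENNReal.mul_inv_cancel (pow_ne_zero _ two_ne_zero) (ENNReal.pow_ne_top ENNReal.ofNat_ne_top), one_mul]

/-- Real bookkeeping of the Chebyshev ratio: for `1 ≤ a < b ≤ 4a`, `0 < ρ`, `0 ≤ c`,
`c b^{1-ρ} / b^{-(1+ρ)/2} / a² ≤ 16 c a^{-(1+ρ)/2}`. [folklore] -/
theorem chebyshev_ratio_le {a b ρ c : ℝ} (hρ : 0 < ρ) (ha : 1 ≤ a) (hab : a < b) (hb4 : b ≤ 4 * a)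
    (hc : 0 ≤ c) :
    c * b ^ (1 - ρ) / b ^ (-((1 + ρ) / 2)) / a ^ 2 ≤ 16 * c * a ^ (-((1 + ρ) / 2)) := by
  have ha0 : 0 < a := lt_of_lt_of_le one_pos ha
  have hb0 : 0 < b := ha0.trans hab
  have e1 : c * b ^ (1 - ρ) / b ^ (-((1 + ρ) / 2)) = c * b ^ ((3 - ρ) / 2) := by
    rw [mul_div_assoc, ← Real.rpow_sub hb0]
    congr 2
    ring
  rw [e1]
  have hba : (b / 4) ^ 2 ≤ a ^ 2 := by
    have : b / 4 ≤ a := by linarith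
    exact pow_le_pow_left₀ (by positivity) this 2
  have hX : 0 ≤ c * b ^ ((3 - ρ) / 2) := by positivity
  calc c * b ^ ((3 - ρ) / 2) / a ^ 2 ≤ c * b ^ ((3 - ρ) / 2) / (b / 4) ^ 2 :=
        div_le_div_of_nonneg_left hX (by positivity) hba
    _ = 16 * c * (b ^ ((3 - ρ) / 2) / b ^ (2 : ℝ)) := by
        rw [Real.rpow_two]; ring
    _ = 16 * c * b ^ (-((1 + ρ) / 2)) := by
        rw [← Real.rpow_sub hb0]; congr 2; ring
    _ ≤ 16 * c * a ^ (-((1 + ρ) / 2)) := by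
        have h := Real.rpow_le_rpow_of_nonpos ha0 hab.le (by linarith : -((1 + ρ) / 2) ≤ 0)
        exact mul_le_mul_of_nonneg_left h (by positivity)

end Summit.NavierStokesRegularity.NavierStokesRegularity.Theorems.PowerGaugeEulerLiouville.Backward

end
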